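import Summits.KontsevichZagierPeriods.KontsevichZagierPeriods.Theorems.SymplecticScissorsGroupToAreas

/-!
# Route SymplecticScissors — `PlanarToAreas` (item stmt-KontsevichZagierPeriods-14941)

Glue edge of the route's frame: planar K₀-injectivity (`PlanarK0Injective`: two planar integrand-1
representations of equal area differ by an element of the planar set-chain group) gives the layer
`N = 2` of the frame in `KZ.Equivalent` form (`PlanarAreas`), by composing with the proved
`GroupToAreas` (`groupToAreas_proof`: the planar set-chain group is contained in `KZ.relations`).

Maintenance note (full-build repair 2026-08-16): the gate-written route file currently renders the
item `PlanarToAreas` (stmt-KontsevichZagierPeriods-14941, `def PlanarToAreas : Prop :=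
PlanarK0Injective → PlanarAreas`, closed · proved) only as a TODO comment ("BLOCKED: missing decl(s)
PlanarAreas; restate via `ledger route edit`"), so the decl
`Theses.SymplecticScissors.PlanarToAreas` does not exist and `planarToAreas_proof` (stated against
it) stopped elaborating. The same implication is therefore restated with the item's body written
out VERBATIM (`PlanarK0Injective → PlanarAreas`, both decls of the route file) under the new name
`planarAreas_of_planarK0Injective` — same proof — and the old name survives as a deprecated alias
(definitionally a proof of `PlanarToAreas` once the planner restates it).
-/

namespace Summit.KontsevichZagierPeriods.SymplecticScissors

open Literature.NumberTheory.Transcendental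

/-- **PlanarToAreas** (route SymplecticScissors, item stmt-KontsevichZagierPeriods-14941):
`PlanarK0Injective → PlanarAreas`, the item's body written out. If two planar integrand-1
representations `r`, `r'` of equal value always satisfy `[r] - [r'] ∈` planar set-chain group,
then they are KZ-equivalent, because the planar set-chain group lies inside `KZ.relations`
(`groupToAreas_proof`). [folklore] -/
theorem planarAreas_of_planarK0Injective :
    Summit.KontsevichZagierPeriods.KontsevichZagierPeriods.Theses.SymplecticScissors.PlanarK0Injective →
      Summit.KontsevichZagierPeriods.KontsevichZagierPeriods.Theses.SymplecticScissors.PlanarAreas := by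
  intro hK r r' hr hr' hv
  exact groupToAreas_proof r r' (hK r r' hr hr' hv)

/-- Deprecated name of `planarAreas_of_planarK0Injective` (it was stated against the route decl
`Theses.SymplecticScissors.PlanarToAreas`, which the gate-written route file currently omits;
full-build repair 2026-08-16). [folklore] -/
@[deprecated planarAreas_of_planarK0Injective (since := "2026-08-16")]
alias planarToAreas_proof := planarAreas_of_planarK0Injective

end Summit.KontsevichZagierPeriods.SymplecticScissors
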